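import Literature.MathematicalPhysics.QuantumFieldTheory.Balaban1983to89.B9CoordSliceMajorant
import Literature.MathematicalPhysics.QuantumFieldTheory.Balaban1983to89.B6QGQCoerciveMultiLevelBox
import Literature.MathematicalPhysics.QuantumFieldTheory.Balaban1983to89.B6Lemma21ParamKLevelTorus

/-!
# `Balaban1983to89.B9SitePinBlockCounts` — [B9] (3.49) p. 399 «x ∈ Δ(y), x′ ∈ Δ(y′)» summed over the input block: THE COUNTING GEOMETRY OF THE
# N06 SITE PINS — block of a site versus the index bond it is pinned to (lengths, distances), `#Δ(y′)·η^{d′}·(L^{j′}η)^{−d′} = 1`, fibre sums over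
# `{w : sI w = y′}`, the member-uniform number of blocks within block distance 1 ([4] Lemma 2.1 (2.61) on the block torus), and the fibre sum of
# ALL-BLOCKS (3.49)-shaped kernel entries

T. Bałaban, *Propagators for lattice gauge theories in a background field*, Commun. Math. Phys. **99** (1985) 389–434 [`Balaban1985BackgroundPropagators`,
"B9"]; [4] = T. Bałaban, *Propagators and renormalization transformations for lattice gauge theories. II*, Commun. Math. Phys. **96** (1984) 223–250
[`Balaban1984PropagatorsII`].  statement-level skeleton of published theorems with citation tags; proofs where landed; nothing here is a claim about
the Yang–Mills mass gap.

THE POINT (dag-n06-d ASK-3 Q2, member-uniform half; sequel of dag-n06-l `B9SiteKernelBlockMajorant`).  The block majorant of a letter's coordinate model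
on n06-d's site carrier `blkSK (sIK bI)` is read from KERNEL entries by summing over the fibre `{w : sIK bI w = y′}` of the pin.  At a member `x` with a
level-faithful (`hlev`) and 1-faithful (`hβ1`) index-bond map `bI` (n06-k's census; n06-i `B9CoordSliceMajorant` for the slack lemmas):
* §1 `dist_sIK_le_distB_add_two` ∕ `exp_distB_le_exp_dist_sIK` (the index-bond distance is within 2 of the block distance — the direction complementary
  to n06-i's `distB_le_dist_sIK_add_two`), `distB_blkOf_le_one_of_sIK` (the blocks met lie within distance 1 of the carrier block), ★ `card_blkOf_mul`
  (`#Δ(y′)·η^{d′}·(L^{j′}η)^{−d′} = 1`, `B6QGQCoerciveMultiLevelBox.card_blkOf_eq`), ★ `sum_fiber_sIK_le` (regrouping a fibre sum by blocks),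
  ★★ `exists_card_nearBlocks_le` (`#{Δ′ : d_T(Δ, Δ′) ≤ 1} ≤ N₁` member-uniformly above an `M`-threshold: (2.61) on the block torus,
  `B6Lemma21ParamKLevelTorus.lemma21Param_kLevelTorusP` under print's (2.59), the pattern of n06-k's `rowSum_geo9K_core`);
* §2 `pref4inv_nonneg ∕ _zero ∕ _one ∕ _two`, ★★ `fiber_sum_fineEntryS_le` — under an ALL-BLOCKS bound `P_n(Δ, Δ′) ≤ C·[1, ℓ⁻¹, ℓ⁻¹, ℓ⁻²]_n(Δ)·ℓ(Δ′)^{−d′}·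
  e^{−θ d_T(Δ,Δ′)}` (n06-i `exists_threshold_349`'s shape): `Σ_{w : sI w = y′} η^{d′}·P_n(Δ(z), Δ(w)) ≤ N₁·C·e^{2θ}·[…]_n(sI z)·e^{−θ d(sI z, y′)}`.
HONEST SCOPE.  Finite bookkeeping on the k-level torus; (3.49) itself is NOT proved here (it enters as the hypothesis `hP`); count-neutral; N06 NOT discharged;
nothing continuum ∕ ℝ⁴ ∕ OS ∕ mass gap ∕ Clay.  Cell `pub-ymgap` (D-0062), node N06 [B9], rows 20–21, seat `pub-ymgap-dag-n06-l` (g15), 2026-08-28.  NEW file; 0 `def`.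
-/

noncomputable section

namespace Literature.MathematicalPhysics.QuantumFieldTheory.Balaban1983to89.B9SitePinBlockCounts

open B6Geom246MultiLevelBox (bset blkOf)
open B6GlobalChartV1 (PV blkV1)
open B6Ineq2142KLevelV1 (lvl β beta_level)
open B6KLevelCensusIndexV1 (KIdx)
open B6Ineq268MultiLevelBox (W W_pos)
open B6QGQCoerciveMultiLevelBox (card_blkOf_eq W_eq_nb_pow nb)
open B6Lemma21Repaired (Ineq261With)
open B6Lemma21OneScaleTorus (exists_cond259)
open B6Lemma21ParamKLevelTorus (lemma21Param_kLevelTorusP)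
open B6Prop22KLevelTorusCensusEta (geoTP)
open B9Ineq349SiteReading (fineEntryS)
open B9Ineq349SiteComposite (lenB distB lenB_eq lenB_pos etaS_pos)
open B9Ineq349SiteFromBlocks (geo9Y_len_eq_lenB geo9Y_dist_eq_distB distB_triangle geo9Y_M_eq)
open B9CoReadingCoordsS (XSK blkSK sIK sIK_level blkV1_site)
open B9CoordSliceMajorant (len_sIK_eq_lenB distB_sIK_le_one distB_comm)
open B9PinMembersKLevelV1 (MemberY geo9Y bg9Y)
open B9GeoLemma21KLevelV1 (geo9Y_len_pos)
open Node00 (SiteY BlkY FBondY IBondY CfgY SiteOpY etaS toKT)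

variable {d ℓ : ℕ} {hd : 1 ≤ d + 1} {hL : Odd (ℓ + 1) ∧ 1 < ℓ + 1} {b₀ b₁ : ℝ} {Mstar : ℕ}

/-! ## §1 Geometry of the site pins: lengths, distances and counts of the block of a site versus the index bond it is pinned to -/

section Pins

variable (x : MemberY d ℓ hd hL b₀ b₁ Mstar) {bI : FBondY x.toKIdx → IBondY x.toKIdx}

/-- the index-bond distance of a 1-faithful map is within `2` of the block distance ((2.54) twice; the direction complementary to n06-i's
`distB_le_dist_sIK_add_two`). [cite: Balaban1984PropagatorsII, (2.45)–(2.46) p.231, (2.51)–(2.52) p.232, bookkeeping] -/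
theorem dist_sIK_le_distB_add_two
    (hβ1 : ∀ f : FBondY x.toKIdx, (B6Geom246MultiLevelTorus.geomT x.D).dist (β x.hN x.D x.hk (bI f)) (blkV1 x.hN x.D f) ≤ 1)
    (z w : SiteY x.toKIdx) :
    (geo9Y x).dist (sIK x.toKIdx bI z) (sIK x.toKIdx bI w) ≤ distB x.toKIdx (blkOf x.D.toDomains z) (blkOf x.D.toDomains w) + 2 := by
  rw [geo9Y_dist_eq_distB]
  have h1 := distB_sIK_le_one x hβ1 z
  have h2 := distB_sIK_le_one x hβ1 w
  rw [distB_comm] at h2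
  have t1 := distB_triangle x.toKIdx (β x.hN x.D x.hk (sIK x.toKIdx bI z)) (blkOf x.D.toDomains z) (β x.hN x.D x.hk (sIK x.toKIdx bI w))
  have t2 := distB_triangle x.toKIdx (blkOf x.D.toDomains z) (blkOf x.D.toDomains w) (β x.hN x.D x.hk (sIK x.toKIdx bI w))
  linarith

/-- the exponential form: `e^{−θ d_T(Δ(z), Δ(w))} ≤ e^{2θ}·e^{−θ d(sI z, sI w)}` for `θ ≥ 0`. [cite: Balaban1984PropagatorsII, (2.45)–(2.46) p.231, (2.51)–(2.52) p.232, bookkeeping] -/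
theorem exp_distB_le_exp_dist_sIK
    (hβ1 : ∀ f : FBondY x.toKIdx, (B6Geom246MultiLevelTorus.geomT x.D).dist (β x.hN x.D x.hk (bI f)) (blkV1 x.hN x.D f) ≤ 1)
    {θ : ℝ} (hθ : 0 ≤ θ) (z w : SiteY x.toKIdx) :
    Real.exp (-(θ * distB x.toKIdx (blkOf x.D.toDomains z) (blkOf x.D.toDomains w))) ≤
      Real.exp (2 * θ) * Real.exp (-(θ * (geo9Y x).dist (sIK x.toKIdx bI z) (sIK x.toKIdx bI w))) := by
  rw [← Real.exp_add]
  apply Real.exp_le_exp.2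
  have h := mul_le_mul_of_nonneg_left (dist_sIK_le_distB_add_two x hβ1 z w) hθ
  linarith

/-- the block of a site pinned to `y′` lies within block distance `1` of the carrier block of `y′`. [cite: Balaban1984PropagatorsII, (2.45)–(2.46) p.231, (2.51)–(2.52) p.232, bookkeeping] -/
theorem distB_blkOf_le_one_of_sIK
    (hβ1 : ∀ f : FBondY x.toKIdx, (B6Geom246MultiLevelTorus.geomT x.D).dist (β x.hN x.D x.hk (bI f)) (blkV1 x.hN x.D f) ≤ 1)
    {w : SiteY x.toKIdx} {y' : IBondY x.toKIdx} (hw : sIK x.toKIdx bI w = y') :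
    distB x.toKIdx (β x.hN x.D x.hk y') (blkOf x.D.toDomains w) ≤ 1 := by
  rw [← hw]; exact distB_sIK_le_one x hβ1 w

/-- the number of sites of a block times `η^{d′}·(Lʲη)^{−d′}` is one (`#Δ(y′) = L^{j′d′}`). [cite: Balaban1984PropagatorsII, (2.45)–(2.46) p.231, (2.51)–(2.52) p.232, bookkeeping] -/
theorem card_blkOf_mul (s : BlkY x.toKIdx) :
    (((Finset.univ.filter fun w : SiteY x.toKIdx => blkOf x.D.toDomains w = s).card : ℕ) : ℝ) *
        (etaS x.toKIdx ^ (d + 1) * lenB x.toKIdx s ^ (-((d + 1 : ℕ) : ℝ))) = 1 := by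
  classical
  have hc : (((Finset.univ.filter fun w : SiteY x.toKIdx => blkOf x.D.toDomains w = s).card : ℕ) : ℝ) =
      (((ℓ : ℝ) + 1) ^ s.1.1) ^ (d + 1) := by
    have h : (((Finset.univ.filter fun w : SiteY x.toKIdx => blkOf x.D.toDomains w = s).card : ℕ) : ℝ) = W x.D.toDomains s :=
      card_blkOf_eq x.D.toDomains s
    rw [h, W_eq_nb_pow]
    simp only [nb, Nat.cast_pow, Nat.cast_add, Nat.cast_one]
  rw [hc, lenB_eq, Real.rpow_neg (mul_pos (by positivity) (etaS_pos _)).le, Real.rpow_natCast, mul_pow]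
  have hη : etaS x.toKIdx ^ (d + 1) ≠ 0 := pow_ne_zero _ (etaS_pos _).ne'
  have hL : (((ℓ : ℝ) + 1) ^ s.1.1) ^ (d + 1) ≠ 0 := by positivity
  field_simp

open Classical in
/-- ★ **THE FIBRE SUM OF A BLOCK FUNCTION**: `Σ_{w : sI w = y′} F(Δ(w)) ≤ Σ_{Δ′ : d_T(β y′, Δ′) ≤ 1} #Δ′·F(Δ′)` for `F ≥ 0` (regroup by blocks; the blocks
met lie within distance 1 of the carrier block). [cite: Balaban1984PropagatorsII, (2.45)–(2.46) p.231, (2.51)–(2.52) p.232, bookkeeping] -/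
theorem sum_fiber_sIK_le
    (hβ1 : ∀ f : FBondY x.toKIdx, (B6Geom246MultiLevelTorus.geomT x.D).dist (β x.hN x.D x.hk (bI f)) (blkV1 x.hN x.D f) ≤ 1)
    (y' : IBondY x.toKIdx) {F : BlkY x.toKIdx → ℝ} (hF : ∀ s, 0 ≤ F s) :
    ∑ w ∈ Finset.univ.filter (fun w : SiteY x.toKIdx => sIK x.toKIdx bI w = y'), F (blkOf x.D.toDomains w) ≤
      ∑ s ∈ Finset.univ.filter (fun s : BlkY x.toKIdx => distB x.toKIdx (β x.hN x.D x.hk y') s ≤ 1),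
        (((Finset.univ.filter fun w : SiteY x.toKIdx => blkOf x.D.toDomains w = s).card : ℕ) : ℝ) * F s := by
  set A := Finset.univ.filter (fun w : SiteY x.toKIdx => sIK x.toKIdx bI w = y') with hA
  set N := Finset.univ.filter (fun s : BlkY x.toKIdx => distB x.toKIdx (β x.hN x.D x.hk y') s ≤ 1) with hN
  have hmaps : ∀ w ∈ A, blkOf x.D.toDomains w ∈ N := fun w hw => by
    rw [hN, Finset.mem_filter]
    exact ⟨Finset.mem_univ _, distB_blkOf_le_one_of_sIK x hβ1 (Finset.mem_filter.1 hw).2⟩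
  rw [← Finset.sum_fiberwise_of_maps_to hmaps]
  refine Finset.sum_le_sum fun s hs => ?_
  rw [Finset.sum_congr rfl fun w hw => by rw [(Finset.mem_filter.1 hw).2], Finset.sum_const, nsmul_eq_mul]
  refine mul_le_mul_of_nonneg_right ?_ (hF s)
  exact_mod_cast Finset.card_le_card (Finset.filter_subset_filter _ (Finset.subset_univ A))

open Classical in
/-- ★ **THE NUMBER OF BLOCKS WITHIN BLOCK DISTANCE 1 OF A BLOCK IS MEMBER-UNIFORMLY BOUNDED above an `M`-threshold** ([4] Lemma 2.1 (2.61) on the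
block torus: every such block contributes `≥ e^{−½δ₀}` to the row sum). [cite: Balaban1984PropagatorsII, (2.45)–(2.46) p.231, (2.51)–(2.52) p.232, bookkeeping] -/
theorem exists_card_nearBlocks_le :
    ∃ ML : ℝ, ∃ N₁ : ℝ, 0 ≤ N₁ ∧ ∀ x : MemberY d ℓ hd hL b₀ b₁ Mstar, ML ≤ (geo9Y x).M →
      ∀ s₀ : BlkY x.toKIdx, ((Finset.univ.filter fun s : BlkY x.toKIdx => distB x.toKIdx s₀ s ≤ 1).card : ℝ) ≤ N₁ := by
  have hℓ1 : 1 ≤ ℓ := by have := hL.2; omega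
  have hL0 : (0 : ℝ) < (ℓ : ℝ) + 1 := by positivity
  set δ₀ : ℝ := min 1 (2 / ((ℓ : ℝ) + 1)) with hδ₀_def
  have hδ₀ : 0 < δ₀ := lt_min one_pos (div_pos two_pos hL0)
  have hδL : δ₀ ≤ 2 / ((ℓ : ℝ) + 1) := min_le_right _ _
  have hα0 : (0 : ℝ) < 1 / 2 := by norm_num
  have hα1 : (1 / 2 : ℝ) < 1 := by norm_num
  have hαδ : 0 < 1 / 2 * δ₀ := by positivity
  obtain ⟨c₁, hc₁0, h21⟩ := lemma21Param_kLevelTorusP d ℓ hℓ1 hδ₀ hδL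
  obtain ⟨R₁, hR₁⟩ := exists_cond259 (d + 1) hαδ
  refine ⟨(R₁ : ℝ), Real.exp (1 / 2 * δ₀) * c₁ (1 / 2), mul_nonneg (Real.exp_nonneg _) (hc₁0 _), fun x hM s₀ => ?_⟩
  have hMh : (1 : ℝ) ≤ (x.Mh : ℝ) := by exact_mod_cast (le_trans (by norm_num) x.hM8 : 1 ≤ x.Mh)
  have hR1 : (1 : ℝ) ≤ (x.R : ℝ) - 1 := by
    have h : 2 * ((ℓ : ℝ) + 1) ^ 2 ≤ (x.R : ℝ) := by exact_mod_cast x.hR2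
    nlinarith [(Nat.cast_nonneg ℓ : (0 : ℝ) ≤ ℓ)]
  have hM' : (R₁ : ℝ) ≤ ((ℓ : ℝ) + 1) * (x.Mh : ℝ) := (geo9Y_M_eq x) ▸ hM
  have hM0 : (0 : ℝ) ≤ ((ℓ : ℝ) + 1) * (x.Mh : ℝ) := by positivity
  have h259 : B6.Cond259 (d + 1) δ₀ (1 / 2) ((geoTP (toKT x.toKIdx)).R - 1) (geoTP (toKT x.toKIdx)).M := by
    show B6.Cond259 (d + 1) δ₀ (1 / 2) ((x.R : ℝ) - 1) (((ℓ : ℝ) + 1) * (x.Mh : ℝ))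
    have h1 := hR₁ 1 le_rfl
    unfold B6.Cond259 at h1 ⊢
    rw [Nat.cast_one, mul_one] at h1
    refine lt_of_lt_of_le h1 ?_
    have hRM : (R₁ : ℝ) ≤ ((x.R : ℝ) - 1) * (((ℓ : ℝ) + 1) * (x.Mh : ℝ)) := le_trans hM' (le_mul_of_one_le_left hM0 hR1)
    calc 1 / 4 * (1 / 2) * δ₀ * (R₁ : ℝ) = (1 / 4 * (1 / 2) * δ₀) * (R₁ : ℝ) := by ring
      _ ≤ (1 / 4 * (1 / 2) * δ₀) * (((x.R : ℝ) - 1) * (((ℓ : ℝ) + 1) * (x.Mh : ℝ))) :=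
          mul_le_mul_of_nonneg_left hRM (by positivity)
      _ = 1 / 4 * (1 / 2) * δ₀ * ((x.R : ℝ) - 1) * (((ℓ : ℝ) + 1) * (x.Mh : ℝ)) := by ring
  obtain ⟨-, h261⟩ := h21 (toKT x.toKIdx) trivial (1 / 2) hα0 hα1 h259
  -- every block within distance 1 contributes at least `e^{−½δ₀}` to the (2.61) row sum at `s₀`
  have hrow : ∑ s : BlkY x.toKIdx, Real.exp (-(1 / 2 * δ₀ * distB x.toKIdx s₀ s)) ≤ c₁ (1 / 2) := h261 s₀
  set Nset := Finset.univ.filter fun s : BlkY x.toKIdx => distB x.toKIdx s₀ s ≤ 1 with hNset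
  have hlow : (Nset.card : ℝ) * Real.exp (-(1 / 2 * δ₀)) ≤ ∑ s : BlkY x.toKIdx, Real.exp (-(1 / 2 * δ₀ * distB x.toKIdx s₀ s)) := by
    rw [← nsmul_eq_mul, ← Finset.sum_const]
    refine le_trans (Finset.sum_le_sum fun s hs => ?_) (Finset.sum_le_univ_sum_of_nonneg fun s => Real.exp_nonneg _)
    have hs1 : distB x.toKIdx s₀ s ≤ 1 := (Finset.mem_filter.1 hs).2
    exact Real.exp_le_exp.2 (neg_le_neg (by nlinarith [hαδ.le]))
  have hexp : 0 < Real.exp (-(1 / 2 * δ₀)) := Real.exp_pos _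
  calc (Nset.card : ℝ) = (Nset.card : ℝ) * Real.exp (-(1 / 2 * δ₀)) * Real.exp (1 / 2 * δ₀) := by
        rw [mul_assoc, ← Real.exp_add, neg_add_cancel, Real.exp_zero, mul_one]
    _ ≤ c₁ (1 / 2) * Real.exp (1 / 2 * δ₀) := mul_le_mul_of_nonneg_right (hlow.trans hrow) (Real.exp_nonneg _)
    _ = Real.exp (1 / 2 * δ₀) * c₁ (1 / 2) := mul_comm _ _

end Pins

/-! ## §2 The counting inequality: all-blocks (3.49) entries summed over a fibre of the site pin -/

section Count

variable {𝔸 : Type} [NormedRing 𝔸] [NormedAlgebra ℂ 𝔸] [CompleteSpace 𝔸]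
variable (x : MemberY d ℓ hd hL b₀ b₁ Mstar) {bI : FBondY x.toKIdx → IBondY x.toKIdx}

/-- `pref4inv t n ≥ 0` for `t > 0`. [cite: Balaban1984PropagatorsII, (2.45)–(2.46) p.231, (2.51)–(2.52) p.232, bookkeeping] -/
theorem pref4inv_nonneg {t : ℝ} (ht : 0 < t) (n : Fin 4) : 0 ≤ B9.pref4inv t n := by
  have h : 0 ≤ t⁻¹ := inv_nonneg.2 ht.le
  have h2 : 0 ≤ t⁻¹ ^ 2 := pow_nonneg h 2
  fin_cases n
  · simp [B9.pref4inv]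
  · simpa [B9.pref4inv] using h
  · simpa [B9.pref4inv] using h
  · simpa [B9.pref4inv] using h2

/-- `pref4inv t 0 = 1`. [cite: Balaban1984PropagatorsII, (2.45)–(2.46) p.231, (2.51)–(2.52) p.232, bookkeeping] -/
theorem pref4inv_zero (t : ℝ) : B9.pref4inv t 0 = 1 := by simp [B9.pref4inv]

/-- `pref4inv t 1 = t⁻¹`. [cite: Balaban1984PropagatorsII, (2.45)–(2.46) p.231, (2.51)–(2.52) p.232, bookkeeping] -/
theorem pref4inv_one (t : ℝ) : B9.pref4inv t 1 = t⁻¹ := by simp [B9.pref4inv]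

/-- `pref4inv t 2 = t⁻¹`. [cite: Balaban1984PropagatorsII, (2.45)–(2.46) p.231, (2.51)–(2.52) p.232, bookkeeping] -/
theorem pref4inv_two (t : ℝ) : B9.pref4inv t 2 = t⁻¹ := by simp [B9.pref4inv]

open Classical in
/-- ★★ **THE COUNTING INEQUALITY**: under an ALL-BLOCKS (3.49)-shaped bound of the entries of `O` at `U` (constant `C`, rate `θ`), a level- and 1-faithful
site pin `sI = sIK bI` and the near-block count `N₁`, the fibre sum of `η^{d′}·P_n(Δ(z), Δ(w))` over `{w : sI w = y′}` is at most
`N₁·C·e^{2θ}·[1, ℓ⁻¹, ℓ⁻¹, ℓ⁻²]_n(sI z)·e^{−θ d(sI z, y′)}` (print: `η^{d′}·#Δ(y′)·(L^{j′}η)^{−d′} = 1`, the blocks met lie within distance 1, (2.54) twice). [cite: Balaban1984PropagatorsII, (2.45)–(2.46) p.231, (2.51)–(2.52) p.232, bookkeeping] -/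
theorem fiber_sum_fineEntryS_le
    (hlev : ∀ f : FBondY x.toKIdx, lvl x.hN x.D x.hk (bI f) = (blkV1 x.hN x.D f).1.1)
    (hβ1 : ∀ f : FBondY x.toKIdx, (B6Geom246MultiLevelTorus.geomT x.D).dist (β x.hN x.D x.hk (bI f)) (blkV1 x.hN x.D f) ≤ 1)
    {N₁ : ℝ} (hN₁ : ∀ s₀ : BlkY x.toKIdx, ((Finset.univ.filter fun s : BlkY x.toKIdx => distB x.toKIdx s₀ s ≤ 1).card : ℝ) ≤ N₁)
    (O : SiteOpY 𝔸 x.toKIdx) (U : CfgY 𝔸 x.toKIdx) {C θ : ℝ} (hC : 0 ≤ C) (hθ : 0 ≤ θ)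
    (hP : ∀ (n : Fin 4) (s s' : BlkY x.toKIdx), fineEntryS x.toKIdx O U s s' n ≤
      C * B9.pref4inv (lenB x.toKIdx s) n * lenB x.toKIdx s' ^ (-((d + 1 : ℕ) : ℝ)) * Real.exp (-(θ * distB x.toKIdx s s')))
    (n : Fin 4) (z : SiteY x.toKIdx) (y' : IBondY x.toKIdx) :
    ∑ w ∈ Finset.univ.filter (fun w : SiteY x.toKIdx => sIK x.toKIdx bI w = y'),
        etaS x.toKIdx ^ (d + 1) * fineEntryS x.toKIdx O U (blkOf x.D.toDomains z) (blkOf x.D.toDomains w) n ≤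
      N₁ * C * Real.exp (2 * θ) * B9.pref4inv ((geo9Y x).len (sIK x.toKIdx bI z)) n *
        Real.exp (-(θ * (geo9Y x).dist (sIK x.toKIdx bI z) y')) := by
  set s := blkOf x.D.toDomains z with hs
  set pf := B9.pref4inv (lenB x.toKIdx s) n with hpf
  have hpf0 : 0 ≤ pf := pref4inv_nonneg (lenB_pos x.toKIdx s) n
  set E := Real.exp (-(θ * (geo9Y x).dist (sIK x.toKIdx bI z) y')) with hE
  set T := C * pf * Real.exp (2 * θ) * E with hT
  have hT0 : 0 ≤ T := by rw [hT]; positivity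
  -- the block function majorising each summand
  set F : BlkY x.toKIdx → ℝ := fun s' => (etaS x.toKIdx ^ (d + 1) * lenB x.toKIdx s' ^ (-((d + 1 : ℕ) : ℝ))) * T with hF
  have hF0 : ∀ s', 0 ≤ F s' := fun s' =>
    mul_nonneg (mul_nonneg (pow_nonneg (etaS_pos _).le _) (Real.rpow_nonneg (lenB_pos x.toKIdx s').le _)) hT0
  have hterm : ∀ w ∈ Finset.univ.filter (fun w : SiteY x.toKIdx => sIK x.toKIdx bI w = y'),
      etaS x.toKIdx ^ (d + 1) * fineEntryS x.toKIdx O U s (blkOf x.D.toDomains w) n ≤ F (blkOf x.D.toDomains w) := by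
    intro w hw
    have hwy : sIK x.toKIdx bI w = y' := (Finset.mem_filter.1 hw).2
    have h1 := hP n s (blkOf x.D.toDomains w)
    have h2 : Real.exp (-(θ * distB x.toKIdx s (blkOf x.D.toDomains w))) ≤ Real.exp (2 * θ) * E := by
      rw [hE, ← hwy]; exact exp_distB_le_exp_dist_sIK x hβ1 hθ z w
    have hη0 : 0 ≤ etaS x.toKIdx ^ (d + 1) := pow_nonneg (etaS_pos _).le _
    have hl0 : 0 ≤ lenB x.toKIdx (blkOf x.D.toDomains w) ^ (-((d + 1 : ℕ) : ℝ)) := Real.rpow_nonneg (lenB_pos x.toKIdx _).le _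
    calc etaS x.toKIdx ^ (d + 1) * fineEntryS x.toKIdx O U s (blkOf x.D.toDomains w) n
        ≤ etaS x.toKIdx ^ (d + 1) * (C * pf * lenB x.toKIdx (blkOf x.D.toDomains w) ^ (-((d + 1 : ℕ) : ℝ)) *
            Real.exp (-(θ * distB x.toKIdx s (blkOf x.D.toDomains w)))) := mul_le_mul_of_nonneg_left h1 hη0
      _ ≤ etaS x.toKIdx ^ (d + 1) * (C * pf * lenB x.toKIdx (blkOf x.D.toDomains w) ^ (-((d + 1 : ℕ) : ℝ)) *
            (Real.exp (2 * θ) * E)) :=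
          mul_le_mul_of_nonneg_left (mul_le_mul_of_nonneg_left h2 (mul_nonneg (mul_nonneg hC hpf0) hl0)) hη0
      _ = F (blkOf x.D.toDomains w) := by rw [hF, hT]; ring
  have hsum := sum_fiber_sIK_le x hβ1 y' hF0
  calc ∑ w ∈ Finset.univ.filter (fun w : SiteY x.toKIdx => sIK x.toKIdx bI w = y'),
          etaS x.toKIdx ^ (d + 1) * fineEntryS x.toKIdx O U s (blkOf x.D.toDomains w) n
      ≤ ∑ w ∈ Finset.univ.filter (fun w : SiteY x.toKIdx => sIK x.toKIdx bI w = y'), F (blkOf x.D.toDomains w) :=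
        Finset.sum_le_sum hterm
    _ ≤ ∑ s' ∈ Finset.univ.filter (fun s' : BlkY x.toKIdx => distB x.toKIdx (β x.hN x.D x.hk y') s' ≤ 1),
          (((Finset.univ.filter fun w : SiteY x.toKIdx => blkOf x.D.toDomains w = s').card : ℕ) : ℝ) * F s' := hsum
    _ = ∑ _s' ∈ Finset.univ.filter (fun s' : BlkY x.toKIdx => distB x.toKIdx (β x.hN x.D x.hk y') s' ≤ 1), T := by
        refine Finset.sum_congr rfl fun s' _ => ?_
        rw [hF, ← mul_assoc, card_blkOf_mul x s', one_mul]
    _ = ((Finset.univ.filter fun s' : BlkY x.toKIdx => distB x.toKIdx (β x.hN x.D x.hk y') s' ≤ 1).card : ℝ) * T := by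
        rw [Finset.sum_const, nsmul_eq_mul]
    _ ≤ N₁ * T := mul_le_mul_of_nonneg_right (hN₁ _) hT0
    _ = N₁ * C * Real.exp (2 * θ) * B9.pref4inv ((geo9Y x).len (sIK x.toKIdx bI z)) n * E := by
        rw [hT, hpf, len_sIK_eq_lenB x hlev z]; ring

end Count

end Literature.MathematicalPhysics.QuantumFieldTheory.Balaban1983to89.B9SitePinBlockCounts

end
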